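import Summits.HodgeConjecture.CorCM.Census.OddSliceFacesSquares
import Summits.HodgeConjecture.CorCM.Census.DicyclicTwistModel

/-!
# The dicyclic twist `Dic(A) ⊃ ℤ/2 × A`, II: the three kinds of rank-four faces, their marginals, and their motions

COR-CM (cell `pub-hodgecm2`, stage 2 of the Hodge ladder), count-neutral KERNEL COMBINATORICS by the binder seat b23 (gen 42; claim
DICYCLIC-COLUMN, HOME/INBOX.md l.10328): part II of the lane `DicyclicTwistModel` → `DicyclicTwistFaces` → `DicyclicTwistSquares` → … .
Bookkeeping definitions with bodies (`faceVec₀`, `faceVec₁`, `faceVecM`) + theorems on top of part I and seat b09's odd slice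
(`Census/OddSliceFacesModel.lean`, `Census/OddSliceFacesSquares.lean`: `faceVec`, `pairVec`, `tw`, `δ`), used BY NAME; no `decide` table, no
certificate, no named fact, no geometry, no `sorry`.  `Interfaces.lean` (C1), every E term, B01, `Transposition/*`, `PortJoin/*` untouched.
HONEST FRAMING: `HC_CM` is NOT proved, here or anywhere in the tree; nothing here is a period, a count of record or a headline.

CONTENT (dictionary of part I: labels of `(Dic(A), c)` = pairs `(ψ₀, ψ₁)` of odd-slice labels, motions `twH`, `twX`, translates `translH`,
`translX`, marginals `marg₀`, `marg₁`, `hodge₂`, `pairs₂`).  The `2|A|` places of `G = Dic(A)` over `F^A`-analogue are the `|A|` places of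
`H = ℤ/2 × A` and the `|A|` places of the coset `xH`; a rank-four face of `G` (a CM type and two distinct places) is therefore one of:
* §1 a **`0`-coordinate face** `faceVec₀ φ i j ψ` — b09's face `(φ; i, j)` of `H` in the `0`-coordinate over the passive label `ψ`, corners
  `(φ,ψ), (φ̄^{(i)}, ψ̄), (φ̄^{(j)}, ψ̄), (φ^{(ij)}, ψ)` (conjugation in `G` is diagonal); a **`1`-coordinate face** `faceVec₁ ψ φ i j`; or a
  **mixed face** `faceVecM φ i ψ j` (the place `i` of `H`, the place `j` of `xH`), corners `(φ,ψ), (φ̄^{(i)}, ψ̄), (φ̄, ψ̄^{(j)}), (φ^{(i)}, ψ^{(j)})`.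
* §1 their marginals: b09's face class in the active coordinate and twice the passive pair (`marg₀_faceVec₀`, `marg₁_faceVec₀`, …), two pairs
  in each coordinate for a mixed face (`marg₀_faceVecM`, `marg₁_faceVecM`) — so ALL FACE CLASSES ARE HODGE (`faceVec₀_mem`, `faceVec₁_mem`
  (`i ≠ j`), `faceVecM_mem` (no condition)).
* §2 the motions permute pairs and faces: `translH_pairVec₂`, `translX_pairVec₂`, `P₂` is stable (`translH_mem_pairs₂`, `translX_mem_pairs₂`);
  an `h`-translate of a face is the face of the same kind through the moved labels at the shifted places (`translH_faceVec₀/₁/M`); **the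
  `x`-translate of a `0`-coordinate face is a `1`-coordinate face** through the reversed labels at the negated places and conversely
  (`translX_faceVec₀`, `translX_faceVec₁`), and the `x`-translate of a mixed face is a mixed face with coordinates and places swapped
  (`translX_faceVecM`).  All [folklore].

## References
* [Pohlmann1968] H. Pohlmann, Algebraic cycles on abelian varieties of complex multiplication type, Ann. of Math. 88 (1968), Thm 1.
* [Milne1999] J. S. Milne, Lefschetz motives and the Tate conjecture, Compositio Math. 117 (1999), Prop. 2.1, p. 54.
-/

namespace Summit.HodgeConjecture.CorCM.Census.DicyclicTwist

open Finset
open Summit.HodgeConjecture.CorCM.Census.OddSliceFacesModel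
open Summit.HodgeConjecture.CorCM.Census.OddSliceFacesSquares

variable (A : Type) [AddCommGroup A] [Fintype A] [DecidableEq A]

/-! ## §1 Faces and their marginals -/

/-- **The `0`-coordinate face** `(φ; i, j | ψ)` (both places in `H`): corners `(φ,ψ), (φ̄^{(i)}, ψ̄), (φ̄^{(j)}, ψ̄), (φ^{(ij)}, ψ)`.
[folklore] -/
def faceVec₀ (φ : Ty A) (i j : A) (ψ : Ty A) : Ty₂ A → ℤ :=
  Pi.single (φ, ψ) 1 + Pi.single (φ + 1 + δ A i, ψ + 1) 1 + Pi.single (φ + 1 + δ A j, ψ + 1) 1 +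
    Pi.single (φ + δ A i + δ A j, ψ) 1

/-- **The `1`-coordinate face** `(ψ | φ; i, j)` (both places in `xH`): corners `(ψ,φ), (ψ̄, φ̄^{(i)}), (ψ̄, φ̄^{(j)}), (ψ, φ^{(ij)})`.
[folklore] -/
def faceVec₁ (ψ : Ty A) (φ : Ty A) (i j : A) : Ty₂ A → ℤ :=
  Pi.single (ψ, φ) 1 + Pi.single (ψ + 1, φ + 1 + δ A i) 1 + Pi.single (ψ + 1, φ + 1 + δ A j) 1 +
    Pi.single (ψ, φ + δ A i + δ A j) 1

/-- **The mixed face** `(φ; i | ψ; j)` (the place `i` of `H` and the place `j` of `xH`): corners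
`(φ,ψ), (φ̄^{(i)}, ψ̄), (φ̄, ψ̄^{(j)}), (φ^{(i)}, ψ^{(j)})`. [folklore] -/
def faceVecM (φ : Ty A) (i : A) (ψ : Ty A) (j : A) : Ty₂ A → ℤ :=
  Pi.single (φ, ψ) 1 + Pi.single (φ + 1 + δ A i, ψ + 1) 1 + Pi.single (φ + 1, ψ + 1 + δ A j) 1 +
    Pi.single (φ + δ A i, ψ + δ A j) 1

omit [AddCommGroup A] in
/-- **The `0`-marginal of a `0`-coordinate face is b09's face class.** [folklore] -/
theorem marg₀_faceVec₀ (φ : Ty A) (i j : A) (ψ : Ty A) : marg₀ A (faceVec₀ A φ i j ψ) = faceVec A φ i j := by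
  simp only [faceVec₀, map_add, marg₀_single, faceVec]

omit [AddCommGroup A] in
/-- The `1`-marginal of a `0`-coordinate face is twice the passive pair. [folklore] -/
theorem marg₁_faceVec₀ (φ : Ty A) (i j : A) (ψ : Ty A) : marg₁ A (faceVec₀ A φ i j ψ) = 2 • pairVec A ψ := by
  simp only [faceVec₀, map_add, marg₁_single, pairVec, two_smul]
  abel

omit [AddCommGroup A] in
/-- The `0`-marginal of a `1`-coordinate face is twice the passive pair. [folklore] -/
theorem marg₀_faceVec₁ (ψ : Ty A) (φ : Ty A) (i j : A) : marg₀ A (faceVec₁ A ψ φ i j) = 2 • pairVec A ψ := by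
  simp only [faceVec₁, map_add, marg₀_single, pairVec, two_smul]
  abel

omit [AddCommGroup A] in
/-- **The `1`-marginal of a `1`-coordinate face is b09's face class.** [folklore] -/
theorem marg₁_faceVec₁ (ψ : Ty A) (φ : Ty A) (i j : A) : marg₁ A (faceVec₁ A ψ φ i j) = faceVec A φ i j := by
  simp only [faceVec₁, map_add, marg₁_single, faceVec]

omit [AddCommGroup A] in
/-- **The `0`-marginal of a mixed face is a sum of two pairs.** [folklore] -/
theorem marg₀_faceVecM (φ : Ty A) (i : A) (ψ : Ty A) (j : A) :
    marg₀ A (faceVecM A φ i ψ j) = pairVec A φ + pairVec A (φ + δ A i) := by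
  simp only [faceVecM, map_add, marg₀_single, pairVec]
  rw [add_right_comm φ 1 (δ A i)]
  abel

omit [AddCommGroup A] in
/-- **The `1`-marginal of a mixed face is a sum of two pairs.** [folklore] -/
theorem marg₁_faceVecM (φ : Ty A) (i : A) (ψ : Ty A) (j : A) :
    marg₁ A (faceVecM A φ i ψ j) = pairVec A ψ + pairVec A (ψ + δ A j) := by
  simp only [faceVecM, map_add, marg₁_single, pairVec]
  rw [add_right_comm ψ 1 (δ A j)]
  abel

omit [AddCommGroup A] in
/-- Twice a pair is a Hodge vector. [folklore] -/
theorem two_smul_pairVec_mem (ψ : Ty A) : (2 : ℕ) • pairVec A ψ ∈ hodge A :=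
  Submodule.smul_of_tower_mem _ 2 (pairVec_mem A ψ)

omit [AddCommGroup A] in
/-- **`0`-coordinate face classes are Hodge vectors** (`i ≠ j`). [folklore] -/
theorem faceVec₀_mem (φ : Ty A) {i j : A} (hij : i ≠ j) (ψ : Ty A) : faceVec₀ A φ i j ψ ∈ hodge₂ A := by
  rw [mem_hodge₂_iff, marg₀_faceVec₀, marg₁_faceVec₀]
  exact ⟨faceVec_mem A φ hij, two_smul_pairVec_mem A ψ⟩

omit [AddCommGroup A] in
/-- **`1`-coordinate face classes are Hodge vectors** (`i ≠ j`). [folklore] -/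
theorem faceVec₁_mem (ψ : Ty A) (φ : Ty A) {i j : A} (hij : i ≠ j) : faceVec₁ A ψ φ i j ∈ hodge₂ A := by
  rw [mem_hodge₂_iff, marg₀_faceVec₁, marg₁_faceVec₁]
  exact ⟨two_smul_pairVec_mem A ψ, faceVec_mem A φ hij⟩

omit [AddCommGroup A] in
/-- **Mixed face classes are Hodge vectors** (no condition on the places: they lie in different cosets). [folklore] -/
theorem faceVecM_mem (φ : Ty A) (i : A) (ψ : Ty A) (j : A) : faceVecM A φ i ψ j ∈ hodge₂ A := by
  rw [mem_hodge₂_iff, marg₀_faceVecM, marg₁_faceVecM]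
  exact ⟨(hodge A).add_mem (pairVec_mem A _) (pairVec_mem A _), (hodge A).add_mem (pairVec_mem A _) (pairVec_mem A _)⟩

/-! ## §2 The motions permute pairs and faces -/

omit [DecidableEq A] in
/-- The `h`-translate of a pair is the pair through the moved label. [folklore] -/
theorem translH_pairVec₂ (g : ZMod 2 × A) (Ψ : Ty₂ A) : translH A g (pairVec₂ A Ψ) = pairVec₂ A (twH A g Ψ) := by
  rw [← translHHom_apply, pairVec₂, map_add, translHHom_apply, translHHom_apply, translH_single, translH_single, pairVec₂,
    conj_eq_twH, conj_eq_twH, twH_twH, twH_twH, add_comm ((1 : ZMod 2), (0 : A)) g]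

omit [DecidableEq A] in
/-- The `x`-translate of a pair is the pair through the moved label. [folklore] -/
theorem translX_pairVec₂ (Ψ : Ty₂ A) : translX A (pairVec₂ A Ψ) = pairVec₂ A (twX A Ψ) := by
  rw [← translXHom_apply, pairVec₂, map_add, translXHom_apply, translXHom_apply, translX_single, translX_single, pairVec₂,
    conj_eq_twH, conj_eq_twH, twX_twH]
  simp

omit [DecidableEq A] in
/-- **`P₂` is stable under the diagonal motions.** [folklore] -/
theorem translH_mem_pairs₂ (g : ZMod 2 × A) {v : Ty₂ A → ℤ} (hv : v ∈ pairs₂ A) : translH A g v ∈ pairs₂ A := by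
  rw [← translHHom_apply]
  refine Submodule.span_induction (p := fun w _ => translHHom A g w ∈ pairs₂ A) ?_ ?_ ?_ ?_ hv
  · rintro _ ⟨Ψ, rfl⟩
    rw [translHHom_apply, translH_pairVec₂]
    exact Submodule.subset_span ⟨_, rfl⟩
  · rw [map_zero]; exact Submodule.zero_mem _
  · intro x y _ _ hx hy; rw [map_add]; exact Submodule.add_mem _ hx hy
  · intro c x _ hx; rw [map_smul]; exact Submodule.smul_mem _ c hx

omit [DecidableEq A] in
/-- **`P₂` is stable under the swap-twist.** [folklore] -/
theorem translX_mem_pairs₂ {v : Ty₂ A → ℤ} (hv : v ∈ pairs₂ A) : translX A v ∈ pairs₂ A := by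
  rw [← translXHom_apply]
  refine Submodule.span_induction (p := fun w _ => translXHom A w ∈ pairs₂ A) ?_ ?_ ?_ ?_ hv
  · rintro _ ⟨Ψ, rfl⟩
    rw [translXHom_apply, translX_pairVec₂]
    exact Submodule.subset_span ⟨_, rfl⟩
  · rw [map_zero]; exact Submodule.zero_mem _
  · intro x y _ _ hx hy; rw [map_add]; exact Submodule.add_mem _ hx hy
  · intro c x _ hx; rw [map_smul]; exact Submodule.smul_mem _ c hx

/-- **An `h`-translate of a `0`-coordinate face is the `0`-coordinate face through the moved labels at the shifted places.** [folklore] -/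
theorem translH_faceVec₀ (g : ZMod 2 × A) (φ : Ty A) (i j : A) (ψ : Ty A) :
    translH A g (faceVec₀ A φ i j ψ) = faceVec₀ A (tw A g φ) (i - g.2) (j - g.2) (tw A g ψ) := by
  rw [← translHHom_apply, faceVec₀, map_add, map_add, map_add]
  simp only [translHHom_apply, translH_single, twH, tw_add_delta, tw_add_one]
  rfl

/-- **An `h`-translate of a `1`-coordinate face.** [folklore] -/
theorem translH_faceVec₁ (g : ZMod 2 × A) (ψ : Ty A) (φ : Ty A) (i j : A) :
    translH A g (faceVec₁ A ψ φ i j) = faceVec₁ A (tw A g ψ) (tw A g φ) (i - g.2) (j - g.2) := by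
  rw [← translHHom_apply, faceVec₁, map_add, map_add, map_add]
  simp only [translHHom_apply, translH_single, twH, tw_add_delta, tw_add_one]
  rfl

/-- **An `h`-translate of a mixed face.** [folklore] -/
theorem translH_faceVecM (g : ZMod 2 × A) (φ : Ty A) (i : A) (ψ : Ty A) (j : A) :
    translH A g (faceVecM A φ i ψ j) = faceVecM A (tw A g φ) (i - g.2) (tw A g ψ) (j - g.2) := by
  rw [← translHHom_apply, faceVecM, map_add, map_add, map_add]
  simp only [translHHom_apply, translH_single, twH, tw_add_delta, tw_add_one]
  rfl

/-- **The `x`-translate of a `0`-coordinate face is a `1`-coordinate face** (through the reversed labels, at the negated places).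
[folklore] -/
theorem translX_faceVec₀ (φ : Ty A) (i j : A) (ψ : Ty A) :
    translX A (faceVec₀ A φ i j ψ) = faceVec₁ A (rev A ψ) (rev A φ + 1) (-i) (-j) := by
  rw [← translXHom_apply, faceVec₀, map_add, map_add, map_add]
  simp only [translXHom_apply, translX_single, twX, rev_add_delta, rev_add_one, faceVec₁, add_one_add_one]
  have e1 : rev A φ + 1 + δ A (-i) + 1 = rev A φ + δ A (-i) := by rw [add_right_comm (rev A φ + 1), add_one_add_one]
  have e2 : rev A φ + 1 + δ A (-j) + 1 = rev A φ + δ A (-j) := by rw [add_right_comm (rev A φ + 1), add_one_add_one]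
  have e3 : rev A φ + δ A (-i) + δ A (-j) + 1 = rev A φ + 1 + δ A (-i) + δ A (-j) := by abel
  rw [e1, e2, e3]

/-- **The `x`-translate of a `1`-coordinate face is a `0`-coordinate face.** [folklore] -/
theorem translX_faceVec₁ (ψ : Ty A) (φ : Ty A) (i j : A) :
    translX A (faceVec₁ A ψ φ i j) = faceVec₀ A (rev A φ) (-i) (-j) (rev A ψ + 1) := by
  rw [← translXHom_apply, faceVec₁, map_add, map_add, map_add]
  simp only [translXHom_apply, translX_single, twX, rev_add_delta, rev_add_one, faceVec₀, add_one_add_one]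

/-- **The `x`-translate of a mixed face is a mixed face** (coordinates and places swapped and negated). [folklore] -/
theorem translX_faceVecM (φ : Ty A) (i : A) (ψ : Ty A) (j : A) :
    translX A (faceVecM A φ i ψ j) = faceVecM A (rev A ψ) (-j) (rev A φ + 1) (-i) := by
  rw [← translXHom_apply, faceVecM, map_add, map_add, map_add]
  simp only [translXHom_apply, translX_single, twX, rev_add_delta, rev_add_one, faceVecM, add_one_add_one]
  have e1 : rev A φ + 1 + δ A (-i) + 1 = rev A φ + δ A (-i) := by rw [add_right_comm (rev A φ + 1), add_one_add_one]
  have e2 : rev A φ + δ A (-i) + 1 = rev A φ + 1 + δ A (-i) := add_right_comm _ _ _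
  rw [e1, e2]
  abel

end Summit.HodgeConjecture.CorCM.Census.DicyclicTwist
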